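import Mathlib
import Summits.Ventures.HodgeRepro2.Tier7.Line1.SepAct
import Summits.Ventures.HodgeRepro2.Tier7.Line1.SepModuleIrred
import Summits.Ventures.HodgeRepro2.Tier7.Target

/-!
# Tier7/Line1/SepActH10 — `H¹⁰`, `H¹⁰·H¹⁰ = ι(M)` and the Hecke-stable subspaces of the separating datum

The SEPARATING DATUM of t7-L1-p2 (LINE L1, residual probe). `H10 ⊂ HXS J` = the holomorphic classes of the
first curve `holA u`, the scalar combinations of `e₀, e₁`, and the junk (the junk is harmless: it is killed by every
product). `H10 * H10 = range ι` (`H10_mul_H10`), `G` preserves `H10` (`act_H10`), and a subspace of `H10 * H10` is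
`HeckeStable G` iff its preimage in the model `M` is `StableM` (`heckeStable_iff_stableM`), so the classification
`stableM_cases` of `SepModuleIrred` reads: the Hecke-stable subspaces of `H10 * H10` are `⊥`, `ι(P_A)`, `ι(P_B)`,
`H10 * H10` (`heckeStable_cases`). Author: t7-L1-p2 (prover-pub-hodge-repro2-t7-L1-p2-g0-0). §8(d): NO.
-/

namespace Summit.Ventures.HodgeRepro2.Tier7.Line1.Sep

open Finset Summit.Ventures.HodgeRepro2.Tier7

noncomputable section

variable {J : Type} [AddCommGroup J] [Module ℂ J]

/-! ## The classes of the second curve -/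

/-- the holomorphic classes `e k` of the second curve -/
def eH (k : Fin 2) : HXS J := ⟨0, (Pi.single k 1, 0), 0, 0⟩

/-- the antiholomorphic classes `ē k` of the second curve -/
def eHbar (k : Fin 2) : HXS J := ⟨0, (0, Pi.single k 1), 0, 0⟩

/-- the top class `t₂` of the second curve -/
def topH : HXS J := ⟨0, 0, 1, 0⟩

/-- the inclusion of the first curve -/
def incA : A₁ →+* HXS J where
  toFun a := ⟨a, 0, 0, 0⟩
  map_one' := by ext <;> simp
  map_mul' _ _ := by ext <;> simp
  map_zero' := by ext <;> simp
  map_add' _ _ := by ext <;> simp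

/-- `incA` unfolded -/
@[simp] theorem incA_apply (a : A₁) : (incA a : HXS J) = ⟨a, 0, 0, 0⟩ := rfl

/-- `β₂` on the unit vectors -/
theorem β₂_single (k l : Fin 2) :
    β₂ ((Pi.single k (1 : A₁), 0) : V₂) ((0, Pi.single l 1) : V₂) = if k = l then 1 else 0 := by
  fin_cases k <;> fin_cases l <;> simp [β₂_apply, Fin.sum_univ_two]

/-- `e k * ē l = δ_{kl} t₂` -/
theorem eH_mul_eHbar (k l : Fin 2) : (eH k : HXS J) * eHbar l = if k = l then topH else 0 := by
  have h := β₂_single k l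
  split_ifs with hkl
  · subst hkl
    simp only [if_true] at h
    simp only [eH, eHbar, topH]; ext <;> simp [h]
  · simp only [hkl, if_false] at h
    simp only [eH, eHbar]; ext <;> simp [h]

/-! ## `H¹⁰` -/

/-- `holA` as a linear map -/
def holAL : U →ₗ[ℂ] A₁ where
  toFun := holA
  map_add' := holA_add
  map_smul' := holA_smul

/-- `holAL` unfolded -/
@[simp] theorem holAL_apply (u : U) : holAL u = holA u := rfl

/-- the scalars inside `Fin 2 → A₁` -/
def scalarL : (Fin 2 → ℂ) →ₗ[ℂ] (Fin 2 → A₁) :=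
  LinearMap.pi fun k => (Algebra.linearMap ℂ A₁).comp (LinearMap.proj k)

/-- `scalarL` unfolded -/
@[simp] theorem scalarL_apply (z : Fin 2 → ℂ) (k : Fin 2) : scalarL z k = algebraMap ℂ A₁ (z k) := rfl

/-- `H^{1,0}`: holomorphic classes of the first curve, scalar multiples of `e₀, e₁`, and junk -/
def H10 : Submodule ℂ (HXS J) :=
  (LinearMap.range holAL).comap Curve.cL ⊓
    (LinearMap.range scalarL).comap ((LinearMap.fst ℂ _ _).comp Curve.vL) ⊓
    LinearMap.ker ((LinearMap.snd ℂ _ _).comp Curve.vL) ⊓ LinearMap.ker Curve.tL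

/-- membership in `H10` -/
theorem mem_H10 {x : HXS J} :
    x ∈ H10 ↔ (∃ u, holA u = x.c) ∧ (∃ z, scalarL z = x.v.1) ∧ x.v.2 = 0 ∧ x.t = 0 := by
  simp [H10, Submodule.mem_inf, Submodule.mem_comap, LinearMap.mem_ker, LinearMap.mem_range, and_assoc]

/-- the holomorphic classes of the first curve inside `HXS J` -/
def ιA (u : U) : HXS J := ⟨holA u, 0, 0, 0⟩

/-- `ιA u ∈ H10` -/
theorem ιA_mem_H10 (u : U) : (ιA u : HXS J) ∈ H10 :=
  mem_H10.2 ⟨⟨u, rfl⟩, ⟨0, by simp [ιA]⟩, rfl, rfl⟩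

/-- `scalarL` of a unit vector -/
theorem scalarL_single (k : Fin 2) : scalarL (Pi.single k (1 : ℂ)) = Pi.single k (1 : A₁) := by
  funext j
  by_cases h : j = k
  · subst h; simp
  · simp [h]

/-- `e k ∈ H10` -/
theorem eH_mem_H10 (k : Fin 2) : (eH k : HXS J) ∈ H10 :=
  mem_H10.2 ⟨⟨0, by simp [eH, holA_zero]⟩, ⟨Pi.single k 1, by simp [eH, scalarL_single]⟩, rfl, rfl⟩

/-- `holA u * algebraMap z = z • holA u` -/
theorem holA_mul_algebraMap (u : U) (z : ℂ) : holA u * algebraMap ℂ A₁ z = z • holA u := by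
  rw [mul_comm, ← Algebra.smul_def]

/-- `(holA u).c = 0` -/
@[simp] theorem holA_c (u : U) : (holA u).c = 0 := rfl

/-- a product of two elements of `H10` lies in the image of the model -/
theorem mul_mem_range_ι {a b : HXS J} (ha : a ∈ H10) (hb : b ∈ H10) : a * b ∈ LinearMap.range ι := by
  obtain ⟨⟨u, hu⟩, ⟨z, hz⟩, hv2, ht⟩ := mem_H10.1 ha
  obtain ⟨⟨u', hu'⟩, ⟨z', hz'⟩, hv2', ht'⟩ := mem_H10.1 hb
  refine ⟨fun k => z' k • u + z k • u', ?_⟩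
  rw [ι_apply]
  refine Curve.ext ?_ ?_ ?_ ?_
  · show (0 : A₁) = (a * b).c
    rw [Curve.mul_c, ← hu, ← hu', holA_mul_holA]
  · show ((fun k => holA (z' k • u + z k • u'), 0) : V₂) = (a * b).v
    rw [Curve.mul_v]
    refine Prod.ext (funext fun k => ?_) ?_
    · simp only [Prod.fst_add, Prod.smul_fst, Pi.add_apply, Pi.smul_apply, smul_eq_mul, ← hu, ← hu',
        ← hz, ← hz', scalarL_apply, holA_mul_algebraMap, holA_add, holA_smul]
    · simp only [Prod.snd_add, Prod.smul_snd, hv2, hv2', smul_zero, add_zero]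
  · show (0 : A₁) = (a * b).t
    rw [Curve.mul_t, ← hu, ← hu', ht, ht', β₂_apply, hv2, hv2']
    simp
  · show (0 : Junk J) = (a * b).j
    rw [Curve.mul_j, ← hu, ← hu', Junk.smul_def, Junk.smul_def, holA_c]
    simp

/-- `H10 * H10 ≤ range ι` -/
theorem H10_mul_H10_le : (H10 : Submodule ℂ (HXS J)) * H10 ≤ LinearMap.range ι :=
  Submodule.mul_le.2 fun _ ha _ hb => mul_mem_range_ι ha hb

/-- `ιA u * e k` is the coordinate vector -/
theorem ιA_mul_eH (u : U) (k : Fin 2) :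
    (ιA u : HXS J) * eH k = ⟨0, (Pi.single k (holA u), 0), 0, 0⟩ := by
  refine Curve.ext ?_ ?_ ?_ ?_
  · rw [Curve.mul_c]; simp [ιA, eH]
  · rw [Curve.mul_v]
    refine Prod.ext (funext fun j => ?_) ?_
    · simp only [ιA, eH, Prod.fst_add, Prod.smul_fst, Pi.add_apply, Pi.smul_apply, smul_eq_mul,
        Pi.single_apply]
      split_ifs <;> simp
    · simp [ιA, eH]
  · rw [Curve.mul_t]; simp [ιA, eH]
  · rw [Curve.mul_j]; simp [ιA, eH]

/-- every element of the image of the model is a sum of such products -/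
theorem ι_eq_sum (x : M) : (ι x : HXS J) = ∑ k, ιA (x k) * eH k := by
  simp only [ιA_mul_eH, Fin.sum_univ_two, ι_apply]
  refine Curve.ext ?_ ?_ ?_ ?_
  · simp
  · refine Prod.ext (funext fun j => ?_) ?_
    · fin_cases j <;> simp
    · simp
  · simp
  · simp

/-- `range ι ≤ H10 * H10` -/
theorem range_ι_le_H10_mul_H10 : LinearMap.range ι ≤ (H10 : Submodule ℂ (HXS J)) * H10 := by
  rintro _ ⟨x, rfl⟩
  rw [ι_eq_sum]
  exact Submodule.sum_mem _ fun k _ => Submodule.mul_mem_mul (ιA_mem_H10 (x k)) (eH_mem_H10 k)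

/-- `H10 * H10 = range ι` -/
theorem H10_mul_H10 : (H10 : Submodule ℂ (HXS J)) * H10 = LinearMap.range ι :=
  le_antisymm H10_mul_H10_le range_ι_le_H10_mul_H10

/-! ## `G` preserves `H10` -/

/-- a generator datum whose `σ₁` preserves the holomorphic classes preserves `H10` -/
theorem HAutData.algEquiv_mem_H10 (D : HAutData) (hσ : ∀ u, ∃ u', D.σ₁ (holA u) = holA u')
    {a : HXS J} (ha : a ∈ H10) : D.algEquiv a ∈ H10 := by
  obtain ⟨⟨u, hu⟩, ⟨z, hz⟩, hv2, ht⟩ := mem_H10.1 ha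
  obtain ⟨u', hu'⟩ := hσ u
  rw [HAutData.algEquiv_apply]
  refine mem_H10.2 ⟨⟨u', ?_⟩, ⟨fun k => D.ε k * z (D.π k), ?_⟩, ?_, ?_⟩
  · show holA u' = D.σ₁ a.c
    rw [← hu, hu']
  · show scalarL _ = D.actFun a.v.1
    funext k
    simp only [scalarL_apply, HAutData.actFun_apply, ← hz, AlgEquiv.commutes, map_mul, Algebra.smul_def]
  · show D.actFun a.v.2 = 0
    rw [hv2]; funext k; simp [HAutData.actFun]
  · show D.σ₁ a.t = 0
    rw [ht, map_zero]

/-- every generator preserves `H10` -/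
theorem gen_mem_H10 (s : Bool × Option ℕ) {a : HXS J} (ha : a ∈ H10) : gen J s a ∈ H10 := by
  rcases s with ⟨b, n⟩
  rcases b with _ | _ <;> rcases n with _ | n
  · exact HAutData.algEquiv_mem_H10 _ (fun u => ⟨u, rfl⟩) ha
  · exact HAutData.algEquiv_mem_H10 _ (fun u => ⟨flipU n u, (UAut.flip n).algEquiv₁_holA u⟩) ha
  · exact HAutData.algEquiv_mem_H10 _ (fun u => ⟨u, rfl⟩) ha
  · exact HAutData.algEquiv_mem_H10 _ (fun u => ⟨sgnU n u, (UAut.sgn n).algEquiv₁_holA u⟩) ha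

/-- the Hecke translates preserve `H^{1,0}` -/
theorem act_H10 (g : G) : ∀ a ∈ (H10 : Submodule ℂ (HXS J)), g • a ∈ H10 :=
  lift_gen_prop (J := J) (fun φ => ∀ a ∈ (H10 : Submodule ℂ (HXS J)), φ a ∈ H10)
    (fun a ha => by simpa using ha) (fun s a ha => gen_mem_H10 s ha)
    (fun φ ψ hφ hψ a ha => by rw [AlgEquiv.mul_apply]; exact hφ _ (hψ a ha)) g

/-! ## Hecke-stability and `StableM` -/

/-- the generators on `M` are involutions -/
theorem genM_genM (s : Bool × Option ℕ) (x : M) : genM s (genM s x) = x := by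
  rcases s with ⟨b, n⟩
  rcases b with _ | _ <;> rcases n with _ | n
  · exact swapM_swapM x
  · exact flipM_flipM n x
  · exact signM_signM x
  · exact sgnM_sgnM n x

/-- a `StableM` subspace is stable under the generators -/
theorem StableM.genM_mem {X : Submodule ℂ M} (hX : StableM X) (s : Bool × Option ℕ) {x : M}
    (hx : x ∈ X) : genM s x ∈ X := by
  rcases s with ⟨b, n⟩
  rcases b with _ | _ <;> rcases n with _ | n
  · exact hX.swap_mem x hx
  · exact hX.flip_mem n x hx
  · exact hX.sign_mem x hx
  · exact hX.sgn_mem n x hx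

/-- a `StableM` subspace is stable under `G` -/
theorem StableM.smul_mem {X : Submodule ℂ M} (hX : StableM X) (g : G) {x : M} (hx : x ∈ X) :
    g • x ∈ X := by
  induction g using FreeGroup.induction_on generalizing x with
  | C1 => simpa using hx
  | of s => rw [of_smul_M]; exact hX.genM_mem s hx
  | inv_of s _ =>
    have hinv : (FreeGroup.of s)⁻¹ • x = genM s x := by
      rw [inv_smul_eq_iff, of_smul_M, genM_genM]
    rw [hinv]; exact hX.genM_mem s hx
  | mul a b ha hb => rw [mul_smul]; exact ha (hb hx)

/-- THE TRANSFER OF STABILITY: a subspace of `ι(M)` is Hecke-stable iff its preimage is `StableM` -/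
theorem heckeStable_iff_stableM {X : Submodule ℂ (HXS J)} (hX : X ≤ LinearMap.range ι) :
    HeckeStable G X ↔ StableM (X.comap ι) := by
  constructor
  · intro h
    refine ⟨fun n x hx => ?_, fun n x hx => ?_, fun x hx => ?_, fun x hx => ?_⟩ <;>
      simp only [Submodule.mem_comap] at hx ⊢
    · have := h (FreeGroup.of (false, some n)) _ hx
      rwa [smul_ι, of_smul_M] at this
    · have := h (FreeGroup.of (true, some n)) _ hx
      rwa [smul_ι, of_smul_M] at this
    · have := h (FreeGroup.of (false, none)) _ hx
      rwa [smul_ι, of_smul_M] at this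
    · have := h (FreeGroup.of (true, none)) _ hx
      rwa [smul_ι, of_smul_M] at this
  · intro h g a ha
    obtain ⟨x, rfl⟩ := hX ha
    rw [smul_ι]
    exact h.smul_mem g (Submodule.mem_comap.1 ha)

/-- THE CLASSIFICATION: the Hecke-stable subspaces of `H10 * H10` are `⊥`, `ι(P_A)`, `ι(P_B)`, `H10 * H10` -/
theorem heckeStable_cases {X : Submodule ℂ (HXS J)} (hle : X ≤ H10 * H10) (hX : HeckeStable G X) :
    X = ⊥ ∨ X = (PW 0).map ι ∨ X = (PW sq).map ι ∨ X = H10 * H10 := by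
  rw [H10_mul_H10] at hle ⊢
  have hX' := (heckeStable_iff_stableM hle).1 hX
  have hmap : (X.comap ι).map ι = X := Submodule.map_comap_eq_self hle
  rcases stableM_cases hX' with h | h | h | h
  · left; rw [← hmap, h, Submodule.map_bot]
  · right; left; rw [← hmap, h]
  · right; right; left; rw [← hmap, h]
  · right; right; right; rw [← hmap, h, Submodule.map_top]

/-- the preimage of `ι(PW s)` is `PW s` -/
theorem comap_map_PW (s : ℕ → ℂ) : ((PW s).map (ι (J := J))).comap ι = PW s :=
  Submodule.comap_map_eq_of_injective ι_injective _

/-- `ι(PW s)` is Hecke-stable -/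
theorem heckeStable_map_PW (s : ℕ → ℂ) : HeckeStable G ((PW s).map (ι (J := J))) := by
  rw [heckeStable_iff_stableM LinearMap.map_le_range, comap_map_PW]
  exact stableM_PW s

/-- `ι(PW s) ≠ ⊥` -/
theorem map_PW_ne_bot (s : ℕ → ℂ) (hs : Wmod s ≤ Usub) : (PW s).map (ι (J := J)) ≠ ⊥ := by
  intro h
  apply PW_ne_bot s hs
  rw [← comap_map_PW (J := J) s, h, Submodule.comap_bot, LinearMap.ker_eq_bot.2 ι_injective]

/-- `ι(PW s)` is Hecke-irreducible -/
theorem heckeIrred_map_PW (s : ℕ → ℂ) (hs : Wmod s ≤ Usub) : HeckeIrred G ((PW s).map (ι (J := J))) := by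
  refine ⟨map_PW_ne_bot s hs, heckeStable_map_PW s, fun W hW hWs => ?_⟩
  have hle : W ≤ LinearMap.range ι := hW.trans LinearMap.map_le_range
  have hW' := (heckeStable_iff_stableM hle).1 hWs
  have hmap : (W.comap ι).map ι = W := Submodule.map_comap_eq_self hle
  have hle' : W.comap ι ≤ PW s := by rw [← comap_map_PW (J := J) s]; exact Submodule.comap_mono hW
  rcases eq_or_ne (W.comap ι) ⊥ with h | h
  · left; rw [← hmap, h, Submodule.map_bot]
  · right; rw [← hmap, eq_PW_of_stable hW' hle' h]

/-- `ι(PW s)` lies in `H10 * H10` -/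
theorem map_PW_le (s : ℕ → ℂ) : (PW s).map (ι (J := J)) ≤ H10 * H10 := by
  rw [H10_mul_H10]; exact LinearMap.map_le_range

end

end Summit.Ventures.HodgeRepro2.Tier7.Line1.Sep
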